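import Mathlib
import Literature.Geometry.Symplectic.JHolomorphicMap

/-!
# A-priori estimate for `J`-holomorphic maps, part 1: calculus of word derivatives

Helper file of the lead (c2) for stub `stub_aprioriOf` of line `Sketch`, crux `TameOrBrodyR4`
(stmt-SmoothPoincare4-7826, route SullivanDual). Directional derivatives `(fderiv ℝ u · v)` on
`ℂ = ℝ²`, their commutation (symmetry of second derivatives), the word derivatives
`(iteratedFDeriv ℝ n u · m)` for a constant tuple `m` (one more letter = one more directional
derivative in front; directional derivatives pass inside), the word form `∂₂ g = (J ∘ g) ∂₁ g` of
flat `J`-holomorphicity (`∂₁ = d·(1)`, `∂₂ = d·(i)`), the commutator identity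
`∂₂ w - (J ∘ g) ∂₁ w = (Dⁿ((J∘g) ∂₁g) - (J∘g) ∘ Dⁿ∂₁g)(m)` for `w = Dⁿg · m`, and its Leibniz
bound (only derivatives of `J ∘ g` of order `≥ 1` enter). No new definitions; Mathlib only
(`second_derivative_symmetric`, `iteratedFDeriv_succ_apply_left`, `norm_iteratedFDeriv_clm_apply`,
`ContinuousLinearMap.iteratedFDeriv_comp_left`).
-/

noncomputable section

open scoped ContDiff Topology Nat
open Filter Set Literature.Geometry.Symplectic

-- the registered namespace `Summit.SmoothPoincare4.SmoothPoincare4.…` repeats a component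
set_option linter.dupNamespace false

namespace Summit.SmoothPoincare4.SmoothPoincare4.Cruxes.TameOrBrodyR4.Sketch

namespace Apriori

variable {F : Type*} [NormedAddCommGroup F] [NormedSpace ℝ F]

/-! ### Directional and word derivatives -/

/-- A directional derivative `(du · v)` of a `C^∞` map is `C^∞`. -/
theorem contDiff_fderiv_apply {u : ℂ → F} (hu : ContDiff ℝ ∞ u) (v : ℂ) :
    ContDiff ℝ ∞ (fderiv ℝ u · v) :=
  (hu.fderiv_right (m := ∞) (by simp)).clm_apply contDiff_const

/-- `∂_v ∂_w u (z) = D²u(z)(v)(w)`. -/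
theorem fderiv_fderiv_apply_eq {u : ℂ → F} (hu : ContDiff ℝ ∞ u) (v w z : ℂ) :
    fderiv ℝ (fderiv ℝ u · w) z v = fderiv ℝ (fderiv ℝ u) z v w := by
  have hd : DifferentiableAt ℝ (fderiv ℝ u) z :=
    ((hu.fderiv_right (m := ∞) (by simp)).differentiable (by simp)).differentiableAt
  show fderiv ℝ (fun y => fderiv ℝ u y w) z v = _
  rw [fderiv_clm_apply hd (differentiableAt_const _)]
  simp

/-- **Directional derivatives of a `C^∞` map commute.** -/
theorem fderiv_apply_comm {u : ℂ → F} (hu : ContDiff ℝ ∞ u) (v w : ℂ) :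
    (fderiv ℝ (fderiv ℝ u · w) · v) = (fderiv ℝ (fderiv ℝ u · v) · w) := by
  funext z
  show fderiv ℝ (fderiv ℝ u · w) z v = fderiv ℝ (fderiv ℝ u · v) z w
  rw [fderiv_fderiv_apply_eq hu, fderiv_fderiv_apply_eq hu]
  have h1 : ∀ y, HasFDerivAt u (fderiv ℝ u y) y := fun y =>
    ((hu.differentiable (by simp)) y).hasFDerivAt
  have h2 : HasFDerivAt (fderiv ℝ u) (fderiv ℝ (fderiv ℝ u) z) z :=
    (((hu.fderiv_right (m := ∞) (by simp)).differentiable (by simp)) z).hasFDerivAt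
  exact second_derivative_symmetric h1 h2 _ _

/-- A word derivative `(Dⁿu · m)` of a `C^∞` map is `C^∞`. -/
theorem contDiff_iteratedFDeriv_apply {u : ℂ → F} (hu : ContDiff ℝ ∞ u) (n : ℕ)
    (m : Fin n → ℂ) : ContDiff ℝ ∞ (iteratedFDeriv ℝ n u · m) :=
  (ContinuousMultilinearMap.apply ℝ (fun _ : Fin n => ℂ) F m).contDiff.comp
    (hu.iteratedFDeriv_right (i := n) (m := ∞) (mod_cast le_top))

/-- **One more letter is one more directional derivative in front:**
`D^{n+1}u(z)(m) = ∂_{m 0} (Dⁿu · tail m)(z)`. -/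
theorem iteratedFDeriv_succ_apply_eq_fderiv {u : ℂ → F} (hu : ContDiff ℝ ∞ u) (n : ℕ)
    (m : Fin (n + 1) → ℂ) (z : ℂ) :
    iteratedFDeriv ℝ (n + 1) u z m = fderiv ℝ (iteratedFDeriv ℝ n u · (Fin.tail m)) z (m 0) := by
  rw [iteratedFDeriv_succ_apply_left]
  show _ = fderiv ℝ (fun y => iteratedFDeriv ℝ n u y (Fin.tail m)) z (m 0)
  rw [fderiv_continuousMultilinear_apply_const_apply]
  exact (hu.differentiable_iteratedFDeriv (m := n) (mod_cast ENat.coe_lt_top n)).differentiableAt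

/-- **Directional derivatives pass inside word derivatives:**
`∂_v (Dⁿu · m) = Dⁿ(∂_v u) · m`. -/
theorem fderiv_iteratedFDeriv_apply_comm {u : ℂ → F} (hu : ContDiff ℝ ∞ u) (v : ℂ) :
    ∀ (n : ℕ) (m : Fin n → ℂ),
      (fderiv ℝ (iteratedFDeriv ℝ n u · m) · v) = (iteratedFDeriv ℝ n (fderiv ℝ u · v) · m)
  | 0, m => by
    funext z
    have h0 : (iteratedFDeriv ℝ 0 u · m) = u := funext fun y => iteratedFDeriv_zero_apply m
    show fderiv ℝ (iteratedFDeriv ℝ 0 u · m) z v = iteratedFDeriv ℝ 0 (fderiv ℝ u · v) z m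
    rw [h0, iteratedFDeriv_zero_apply]
  | n + 1, m => by
    have hsucc : (iteratedFDeriv ℝ (n + 1) u · m) =
        (fderiv ℝ (iteratedFDeriv ℝ n u · (Fin.tail m)) · (m 0)) :=
      funext fun z => iteratedFDeriv_succ_apply_eq_fderiv hu n m z
    have hsucc' : (iteratedFDeriv ℝ (n + 1) (fderiv ℝ u · v) · m) =
        (fderiv ℝ (iteratedFDeriv ℝ n (fderiv ℝ u · v) · (Fin.tail m)) · (m 0)) :=
      funext fun z => iteratedFDeriv_succ_apply_eq_fderiv (contDiff_fderiv_apply hu v) n m z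
    rw [hsucc, hsucc', fderiv_apply_comm (contDiff_iteratedFDeriv_apply hu n _),
      fderiv_iteratedFDeriv_apply_comm hu v n (Fin.tail m)]

/-- `‖e_i‖ = 1` for the real basis `e₀ = 1`, `e₁ = i` of `ℂ`. -/
theorem norm_basis_eq_one (i : Fin 2) : ‖(![(1 : ℂ), Complex.I] : Fin 2 → ℂ) i‖ = 1 := by
  fin_cases i <;> simp

/-- `‖Dⁿu(z)(e_L)‖ ≤ ‖Dⁿu(z)‖` on basis tuples. -/
theorem norm_iteratedFDeriv_apply_basis_le (u : ℂ → F) (n : ℕ) (L : Fin n → Fin 2) (z : ℂ) :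
    ‖iteratedFDeriv ℝ n u z (fun j => ![(1 : ℂ), Complex.I] (L j))‖ ≤ ‖iteratedFDeriv ℝ n u z‖ := by
  refine (ContinuousMultilinearMap.le_opNorm _ _).trans ?_
  simp [norm_basis_eq_one]

/-! ### The equation and the commutator source term -/

/-- The flat `J`-holomorphicity equation in word form: `∂₂ g = (J ∘ g) ∂₁ g`. -/
theorem fderiv_apply_I_eq_of_isJHolomorphicFlat {E : Type*} [NormedAddCommGroup E]
    [NormedSpace ℝ E] {J : E → E →L[ℝ] E} {g : ℂ → E} (hgJ : IsJHolomorphicFlat J g) :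
    (fderiv ℝ g · Complex.I) = fun z => J (g z) (fderiv ℝ g z 1) := by
  funext z
  have h := hgJ z 1
  rw [mul_one] at h
  exact h

/-- **The commutator identity.** For a flat-`J`-holomorphic `C^∞` map `g` with `A = J ∘ g` and
`p = ∂₁ g`, the word derivative `w = Dⁿg · m` satisfies
`∂₂ w (z) - A(z) (∂₁ w (z)) = (Dⁿ(A p)(z) - A(z) ∘ Dⁿp(z))(m)`. -/
theorem commutator_identity {E : Type*} [NormedAddCommGroup E] [NormedSpace ℝ E]
    {J : E → E →L[ℝ] E} {g : ℂ → E} (hg : ContDiff ℝ ∞ g)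
    (hgJ : IsJHolomorphicFlat J g) (n : ℕ) (m : Fin n → ℂ) (z : ℂ) :
    fderiv ℝ (iteratedFDeriv ℝ n g · m) z Complex.I -
        J (g z) (fderiv ℝ (iteratedFDeriv ℝ n g · m) z 1) =
      (iteratedFDeriv ℝ n (fun y => J (g y) (fderiv ℝ g y 1)) z -
        (J (g z)).compContinuousMultilinearMap (iteratedFDeriv ℝ n (fderiv ℝ g · 1) z)) m := by
  have hI := congrFun (fderiv_iteratedFDeriv_apply_comm hg Complex.I n m) z
  have h1 := congrFun (fderiv_iteratedFDeriv_apply_comm hg 1 n m) z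
  rw [hI, h1, fderiv_apply_I_eq_of_isJHolomorphicFlat hgJ, sub_apply,
    ContinuousLinearMap.compContinuousMultilinearMap_coe, Function.comp_apply]

/-- **Leibniz bound for the commutator** `Dⁿ(A p)(z) - A(z) ∘ Dⁿp(z)`: only derivatives of `A`
of order `≥ 1` enter (apply the bilinear bound to `y ↦ (A y - A z) (p y)`). -/
theorem norm_commutator_le {A : ℂ → F →L[ℝ] F} {p : ℂ → F} (hA : ContDiff ℝ ∞ A)
    (hp : ContDiff ℝ ∞ p) (n : ℕ) (z : ℂ) :
    ‖iteratedFDeriv ℝ n (fun y => A y (p y)) z -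
        (A z).compContinuousMultilinearMap (iteratedFDeriv ℝ n p z)‖ ≤
      ∑ i ∈ Finset.range n, (n.choose (i + 1) : ℝ) * ‖iteratedFDeriv ℝ (i + 1) A z‖ *
        ‖iteratedFDeriv ℝ (n - (i + 1)) p z‖ := by
  set A' : ℂ → F →L[ℝ] F := fun y => A y - A z with hA'def
  have hA' : ContDiff ℝ ∞ A' := hA.sub contDiff_const
  have hsplit : (fun y => A y (p y)) = (fun y => A' y (p y)) + fun y => A z (p y) := by
    funext y
    simp [A']
  have h1 : iteratedFDeriv ℝ n (fun y => A y (p y)) z =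
      iteratedFDeriv ℝ n (fun y => A' y (p y)) z + iteratedFDeriv ℝ n (fun y => A z (p y)) z := by
    rw [hsplit]
    exact iteratedFDeriv_add_apply ((hA'.clm_apply hp).contDiffAt.of_le (mod_cast le_top))
      ((contDiff_const.clm_apply hp).contDiffAt.of_le (mod_cast le_top))
  have h2 : iteratedFDeriv ℝ n (fun y => A z (p y)) z =
      (A z).compContinuousMultilinearMap (iteratedFDeriv ℝ n p z) :=
    (A z).iteratedFDeriv_comp_left (f := p) (hp.contDiffAt.of_le (mod_cast le_top)) le_rfl
  rw [h1, h2, add_sub_cancel_right]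
  refine (norm_iteratedFDeriv_clm_apply (N := ∞) hA' hp z (mod_cast le_top)).trans (le_of_eq ?_)
  rw [Finset.sum_range_succ']
  have h0 : ‖iteratedFDeriv ℝ 0 A' z‖ = 0 := by simp [A']
  rw [h0]
  simp only [mul_zero, zero_mul, add_zero]
  refine Finset.sum_congr rfl fun i _ => ?_
  congr 2
  have : A' = A - fun _ => A z := rfl
  rw [this, iteratedFDeriv_sub_apply (hA.contDiffAt.of_le (mod_cast le_top))
    (contDiffAt_const.of_le (mod_cast le_top)), iteratedFDeriv_succ_const, Pi.zero_apply, sub_zero]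

/-- `‖D^j (du · v)(z)‖ ≤ ‖v‖ ‖D^{j+1} u (z)‖`. -/
theorem norm_iteratedFDeriv_fderiv_apply_le {u : ℂ → F} (hu : ContDiff ℝ ∞ u) (v : ℂ) (j : ℕ)
    (z : ℂ) : ‖iteratedFDeriv ℝ j (fderiv ℝ u · v) z‖ ≤ ‖v‖ * ‖iteratedFDeriv ℝ (j + 1) u z‖ := by
  have h := norm_iteratedFDeriv_clm_apply_const (f := fderiv ℝ u) (c := v) (x := z) (N := ∞)
    (n := j) ((hu.fderiv_right (m := ∞) (by simp)).contDiffAt) (mod_cast le_top)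
  rw [norm_iteratedFDeriv_fderiv] at h
  exact h

end Apriori

end Summit.SmoothPoincare4.SmoothPoincare4.Cruxes.TameOrBrodyR4.Sketch
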